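import Summits.CriticalPhenomena.PercolationContinuityZ3.Theorems.PercNearOneGluingNoHeavyPcintBSMLazy
import Summits.CriticalPhenomena.PercolationContinuityZ3.Theorems.PercNearOneGluingNoHeavyPcintBSMBlocks
import Summits.CriticalPhenomena.PercolationContinuityZ3.Theorems.PercNearOneGluingNoHeavyPcintOSMMono
import HarnessLib

/-!
# PCINT lane, PHASE 5 (block-renewal second moment), step 3: word sums, marginals and factorisation

Cell `prim-pcint`, seat `prim-pcint-1` (gen 14); memo `run/shared/lean/prim/pcint/T-FIBRE-ROUTE.md` §PHASE 5.

Finite-sum tools for the product formula of the block transition sums (…BSMGreen): (1) the PUSH-FORWARD of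
product weights along a letter map (`BSM.sum_prod_comp`: `Σ_x Π_j ω(x_j) f(φ∘x) = Σ_y Π_j ω̄(y_j) f(y)` with the
fibre weights `ω̄ b = Σ_{φ a = b} ω a`); (2) pairs of words as words of pairs (`BSM.sum_pair_eq`) and the two
FACTORISATIONS of product-weighted sums over words in a product alphabet (`BSM.sum_prod_mul_factor`,
`BSM.sum_prod_pi_factor`); (3) the WORD SUMS of the lazy three-point law: single words `BSM.Wsum s n δ = F s n δ`
(`BSM.Wsum_eq_F`) and pairs `BSM.Apair s n δ = F s (2n) δ` (`BSM.Apair_eq_F`, the transverse offset of two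
independent block walkers in one coordinate); (4) the time offset: `BSM.time_sum_eq_cnt` identifies the pair sum of
the time axes with the tree's oriented pair count `OSM.cnt k n (τ - τ')/k^{2n}`, and **`BSM.u_le_F`** bounds the
oriented meeting probability `OSM.u k n ≤ F (4(k-1)/k²) n 0` (project on the count of one letter: two binomial counts
agree with the return probability of a lazy three-point walk), whence `u k n ² ≤ k²/(4(k-1)(n+1))` (`BSM.u_sq_le`).
-/

noncomputable section

namespace Summit.CriticalPhenomena.PercolationContinuityZ3.Theorems.Pcint.BSM

open Finset OSM

/-! ### Push-forward and factorisation of product-weighted word sums -/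

/-- **Push-forward of product weights along a letter map.** -/
theorem sum_prod_comp {A B : Type*} [Fintype A] [Fintype B] [DecidableEq B] (φ : A → B) (ω : A → ℝ) :
    ∀ (n : ℕ) (f : (Fin n → B) → ℝ),
      ∑ x : Fin n → A, (∏ j, ω (x j)) * f (φ ∘ x) =
        ∑ y : Fin n → B, (∏ j, ∑ a : A, if φ a = y j then ω a else 0) * f y
  | 0, f => by
    rw [Fintype.sum_unique, Fintype.sum_unique]
    simp only [univ_eq_empty, prod_empty, one_mul]
    congr 1
    funext i; exact Fin.elim0 i
  | n + 1, f => by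
    rw [sum_cons, sum_cons]
    -- left: peel the first letter and use the induction hypothesis with `f (cons (φ a) ·)`
    have hL : ∀ a : A, ∑ x : Fin n → A, (∏ j, ω ((Fin.cons a x : Fin (n + 1) → A) j)) * f (φ ∘ Fin.cons a x) =
        ω a * ∑ y : Fin n → B, (∏ j, ∑ a' : A, if φ a' = y j then ω a' else 0) * f (Fin.cons (φ a) y) := by
      intro a
      have ih := sum_prod_comp φ ω n (fun y : Fin n → B => f (Fin.cons (φ a) y))
      rw [← ih, mul_sum]
      refine sum_congr rfl fun x _ => ?_
      rw [Fin.prod_univ_succ, Fin.cons_zero, Fin.comp_cons]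
      simp only [Fin.cons_succ, mul_assoc]
    have hR : ∀ b : B, ∑ y : Fin n → B, (∏ j, ∑ a : A, if φ a = (Fin.cons b y : Fin (n + 1) → B) j then ω a else 0) *
        f (Fin.cons b y) = (∑ a : A, if φ a = b then ω a else 0) *
          ∑ y : Fin n → B, (∏ j, ∑ a' : A, if φ a' = y j then ω a' else 0) * f (Fin.cons b y) := by
      intro b
      rw [mul_sum]
      refine sum_congr rfl fun y _ => ?_
      rw [Fin.prod_univ_succ, Fin.cons_zero]
      simp only [Fin.cons_succ, mul_assoc]
    simp_rw [hL, hR]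
    -- `Σ_a ω a S (φ a) = Σ_b ω̄ b S b`
    set S : B → ℝ := fun b => ∑ y : Fin n → B, (∏ j, ∑ a' : A, if φ a' = y j then ω a' else 0) * f (Fin.cons b y)
    have : ∀ a : A, ω a * S (φ a) = ∑ b : B, (if φ a = b then ω a else 0) * S b := by
      intro a
      have e : ∀ b : B, (if φ a = b then ω a else 0) * S b = if φ a = b then ω a * S b else 0 := fun b => by
        split_ifs <;> simp
      simp_rw [e]
      rw [Finset.sum_ite_eq]
      simp
    change ∑ a : A, ω a * S (φ a) = ∑ b : B, (∑ a : A, if φ a = b then ω a else 0) * S b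
    simp_rw [this, sum_mul]
    exact sum_comm

/-- **Pairs of words are words of pairs.** -/
theorem sum_pair_eq {A A' M : Type*} [Fintype A] [Fintype A'] [AddCommMonoid M] {n : ℕ}
    (f : (Fin n → A) → (Fin n → A') → M) :
    ∑ x : Fin n → A, ∑ x' : Fin n → A', f x x' =
      ∑ ξ : Fin n → A × A', f (fun j => (ξ j).1) (fun j => (ξ j).2) := by
  rw [← Fintype.sum_prod_type']
  refine (Fintype.sum_bijective (fun ξ : Fin n → A × A' => ((fun j => (ξ j).1), (fun j => (ξ j).2)))
    ⟨?_, ?_⟩ _ _ (fun _ => rfl)).symm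
  · intro ξ ξ' h
    simp only [Prod.mk.injEq] at h
    funext j
    exact Prod.ext (congr_fun h.1 j) (congr_fun h.2 j)
  · intro p
    exact ⟨fun j => (p.1 j, p.2 j), rfl⟩

/-- **Binary factorisation** of a product-weighted sum over words in a product alphabet. -/
theorem sum_prod_mul_factor {L₁ L₂ : Type*} [Fintype L₁] [Fintype L₂] {n : ℕ} (ω₁ : L₁ → ℝ) (ω₂ : L₂ → ℝ)
    (f₁ : (Fin n → L₁) → ℝ) (f₂ : (Fin n → L₂) → ℝ) :
    ∑ η : Fin n → L₁ × L₂, (∏ j, (ω₁ (η j).1 * ω₂ (η j).2)) * (f₁ (fun j => (η j).1) * f₂ (fun j => (η j).2)) =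
      (∑ η₁ : Fin n → L₁, (∏ j, ω₁ (η₁ j)) * f₁ η₁) * ∑ η₂ : Fin n → L₂, (∏ j, ω₂ (η₂ j)) * f₂ η₂ := by
  rw [sum_mul_sum, sum_pair_eq (fun η₁ η₂ => (∏ j, ω₁ (η₁ j)) * f₁ η₁ * ((∏ j, ω₂ (η₂ j)) * f₂ η₂))]
  refine sum_congr rfl fun η _ => ?_
  rw [prod_mul_distrib]
  ring

/-- **Coordinatewise factorisation** of a product-weighted sum over words in a power alphabet. -/
theorem sum_prod_pi_factor {M : Type*} [Fintype M] (t n : ℕ) (ω : M → ℝ) (f : Fin t → (Fin n → M) → ℝ) :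
    ∑ η : Fin n → (Fin t → M), (∏ j, ∏ i, ω (η j i)) * ∏ i, f i (fun j => η j i) =
      ∏ i : Fin t, ∑ ζ : Fin n → M, (∏ j, ω (ζ j)) * f i ζ := by
  rw [Fintype.prod_sum]
  rw [← (Equiv.piComm fun (_ : Fin n) (_ : Fin t) => M).sum_comp]
  refine sum_congr rfl fun η _ => ?_
  rw [prod_comm, ← prod_mul_distrib]
  rfl

/-! ### Word sums of the lazy three-point law -/

/-- Single words: `Wsum s n δ = Σ_v Π_j g₃(v_j) 𝟙[Σ_j val v_j = δ]`. -/
def Wsum (s : ℝ) (n : ℕ) (δ : ℤ) : ℝ :=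
  ∑ v : Fin n → Fin 3, (∏ j, g₃ s (v j)) * if ∑ j, val (v j) = δ then 1 else 0

/-- Pairs of words: `Apair s n δ = Σ_ζ Π_j g₃(ζ_j.1) g₃(ζ_j.2) 𝟙[Σ_j (val ζ_j.2 - val ζ_j.1) = δ]`. -/
def Apair (s : ℝ) (n : ℕ) (δ : ℤ) : ℝ :=
  ∑ ζ : Fin n → Fin 3 × Fin 3, (∏ j, (g₃ s (ζ j).1 * g₃ s (ζ j).2)) *
    if ∑ j, (val (ζ j).2 - val (ζ j).1) = δ then 1 else 0

/-- **`Wsum = F`.** -/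
theorem Wsum_eq_F (s : ℝ) : ∀ (n : ℕ) (δ : ℤ), Wsum s n δ = F s n δ
  | 0, δ => by
    rw [Wsum, F_zero, Fintype.sum_unique]
    simp [eq_comm]
  | n + 1, δ => by
    rw [Wsum, sum_cons, F_succ_sum]
    refine sum_congr rfl fun c _ => ?_
    rw [← Wsum_eq_F s n, Wsum, mul_sum]
    refine sum_congr rfl fun v _ => ?_
    rw [Fin.prod_univ_succ, Fin.sum_univ_succ]
    simp only [Fin.cons_zero, Fin.cons_succ]
    have : (val c + ∑ j : Fin n, val (v j) = δ) ↔ (∑ j : Fin n, val (v j) = δ - val c) := by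
      constructor <;> intro h <;> linarith
    simp only [this, mul_assoc]

/-- **`Apair = F (2n)`.** -/
theorem Apair_eq_F (s : ℝ) : ∀ (n : ℕ) (δ : ℤ), Apair s n δ = F s (2 * n) δ
  | 0, δ => by
    rw [Apair, Nat.mul_zero, F_zero, Fintype.sum_unique]
    simp [eq_comm]
  | n + 1, δ => by
    rw [Apair, sum_cons, show 2 * (n + 1) = 2 * n + 1 + 1 by ring, F_succ_sum]
    simp_rw [F_succ_sum' s (2 * n)]
    rw [Fintype.sum_prod_type, sum_comm]
    refine sum_congr rfl fun c' _ => ?_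
    rw [mul_sum]
    refine sum_congr rfl fun c _ => ?_
    rw [← Apair_eq_F s n, Apair, mul_sum, mul_sum]
    refine sum_congr rfl fun ζ _ => ?_
    rw [Fin.prod_univ_succ, Fin.sum_univ_succ]
    simp only [Fin.cons_zero, Fin.cons_succ]
    have : (val c' - val c + ∑ j : Fin n, (val (ζ j).2 - val (ζ j).1) = δ) ↔
        (∑ j : Fin n, (val (ζ j).2 - val (ζ j).1) = δ - val c' + val c) := by
      constructor <;> intro h <;> linarith
    simp only [this]
    ring

/-- `Apair ≥ 0`. -/
theorem Apair_nonneg {s : ℝ} (hs0 : 0 ≤ s) (hs1 : s ≤ 1) (n : ℕ) (δ : ℤ) : 0 ≤ Apair s n δ :=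
  sum_nonneg fun _ _ => mul_nonneg (prod_nonneg fun _ _ => mul_nonneg (g₃_nonneg hs0 hs1 _) (g₃_nonneg hs0 hs1 _))
    (by split_ifs <;> norm_num)

/-! ### The time offset and the tree's oriented pair counts -/

/-- Positions of oriented words as sums of unit vectors. -/
theorem pos_eq_sum_e {k n : ℕ} (w : Fin n → Fin k) : pos w n = ∑ j, e (w j) := by
  funext x
  simp only [pos, Fin.is_lt, true_and, e, Finset.sum_apply, Pi.single_apply]
  refine sum_congr rfl fun j _ => ?_
  by_cases h : w j = x
  · rw [if_pos h, if_pos h.symm]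
  · rw [if_neg h, if_neg (Ne.symm h)]

/-- **The time pair sum is the oriented pair count**:
`Σ_η Π_j (1/k²) 𝟙[τ + Σ_j (e η_j.2 - e η_j.1) = τ'] = cnt k n (τ - τ') / k^{2n}`. -/
theorem time_sum_eq_cnt {k : ℕ} (hk : 0 < k) (n : ℕ) (τ τ' : Fin k → ℤ) :
    ∑ η : Fin n → Fin k × Fin k, (∏ _j : Fin n, (1 : ℝ) / (k : ℝ) ^ 2) *
        (if τ + ∑ j, (e (η j).2 - e (η j).1) = τ' then (1 : ℝ) else 0) =
      cnt k n (τ - τ') / (k : ℝ) ^ (2 * n) := by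
  have hk0 : (0 : ℝ) < k := by exact_mod_cast hk
  have hc : cnt k n (τ - τ') = ∑ η : Fin n → Fin k × Fin k,
      if τ + ∑ j, (e (η j).2 - e (η j).1) = τ' then (1 : ℝ) else 0 := by
    rw [cnt, sum_comm, sum_pair_eq (fun w' w : Fin n → Fin k => if τ - τ' + pos w n = pos w' n then (1 : ℝ) else 0)]
    refine sum_congr rfl fun η _ => ?_
    simp only [pos_eq_sum_e, sum_sub_distrib]
    have hiff : (τ - τ' + ∑ j, e (η j).2 = ∑ j, e (η j).1) ↔ (τ + (∑ j, e (η j).2 - ∑ j, e (η j).1) = τ') := by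
      constructor <;> intro h
      · linear_combination h
      · linear_combination h
    simp only [hiff]
  have hpow : ((1 : ℝ) / (k : ℝ) ^ 2) ^ n * (k : ℝ) ^ (2 * n) = 1 := by
    rw [pow_mul, one_div, inv_pow, inv_mul_cancel₀ (by positivity)]
  rw [hc, eq_div_iff (by positivity), sum_mul]
  refine sum_congr rfl fun η _ => ?_
  rw [prod_const, card_univ, Fintype.card_fin]
  calc ((1 : ℝ) / (k : ℝ) ^ 2) ^ n * (if τ + ∑ j, (e (η j).2 - e (η j).1) = τ' then (1 : ℝ) else 0) * (k : ℝ) ^ (2 * n)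
      = (if τ + ∑ j, (e (η j).2 - e (η j).1) = τ' then (1 : ℝ) else 0) * (((1 : ℝ) / (k : ℝ) ^ 2) ^ n * (k : ℝ) ^ (2 * n)) := by
        ring
    _ = _ := by rw [hpow, mul_one]

/-! ### The oriented meeting probability and the lazy walk -/

/-- The letter map: which of the two letters is the distinguished one. -/
def ψ {k : ℕ} (z0 : Fin k) (p : Fin k × Fin k) : Fin 3 :=
  if p.1 = z0 then (if p.2 = z0 then 1 else 2) else (if p.2 = z0 then 0 else 1)

/-- Its value is the difference of the two indicators. -/
theorem val_ψ {k : ℕ} (z0 : Fin k) (p : Fin k × Fin k) :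
    val (ψ z0 p) = (if p.1 = z0 then (1 : ℤ) else 0) - (if p.2 = z0 then 1 else 0) := by
  unfold ψ val
  split_ifs <;> simp

/-- A two-valued sum over `Fin k`. -/
theorem sum_ite_eq_two {k : ℕ} (z0 : Fin k) (x y : ℝ) :
    ∑ a : Fin k, (if a = z0 then x else y) = x + ((k : ℝ) - 1) * y := by
  have : ∀ a : Fin k, (if a = z0 then x else y) = y + if a = z0 then x - y else 0 := by
    intro a; split_ifs <;> ring
  simp_rw [this]
  rw [sum_add_distrib, sum_const, card_univ, Fintype.card_fin, sum_ite_eq']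
  simp; ring

/-- **The fibre weights of `ψ` are the lazy law** `g₃ (4(k-1)/k²)`. -/
theorem sum_fibre_ψ {k : ℕ} (hk : 1 ≤ k) (z0 : Fin k) (c : Fin 3) :
    ∑ p : Fin k × Fin k, (if ψ z0 p = c then (1 : ℝ) / (k : ℝ) ^ 2 else 0) =
      g₃ (4 * ((k : ℝ) - 1) / (k : ℝ) ^ 2) c := by
  have hk0 : (0 : ℝ) < k := by exact_mod_cast hk
  rw [Fintype.sum_prod_type]
  have inner : ∀ a : Fin k, ∑ a' : Fin k, (if ψ z0 (a, a') = c then (1 : ℝ) / (k : ℝ) ^ 2 else 0) =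
      if a = z0 then ((if (1 : Fin 3) = c then (1 : ℝ) / (k : ℝ) ^ 2 else 0) +
          ((k : ℝ) - 1) * (if (2 : Fin 3) = c then (1 : ℝ) / (k : ℝ) ^ 2 else 0))
        else ((if (0 : Fin 3) = c then (1 : ℝ) / (k : ℝ) ^ 2 else 0) +
          ((k : ℝ) - 1) * (if (1 : Fin 3) = c then (1 : ℝ) / (k : ℝ) ^ 2 else 0)) := by
    intro a
    by_cases ha : a = z0
    · rw [if_pos ha, ← sum_ite_eq_two z0]
      refine sum_congr rfl fun a' _ => ?_
      by_cases ha' : a' = z0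
      · simp [ψ, ha, ha']
      · simp [ψ, ha, ha']
    · rw [if_neg ha, ← sum_ite_eq_two z0]
      refine sum_congr rfl fun a' _ => ?_
      by_cases ha' : a' = z0
      · simp [ψ, ha, ha']
      · simp [ψ, ha, ha']
  simp_rw [inner]
  rw [sum_ite_eq_two z0]
  fin_cases c
  · simp [g₃]; try field_simp; try ring
  · simp [g₃]; try field_simp; try ring
  · simp [g₃]; try field_simp; try ring

/-- **`u k n ≤ F (4(k-1)/k²) n 0`**: two oriented walkers meet no more often than their counts of one letter agree,
and the latter is the return probability of a lazy three-point walk. -/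
theorem u_le_F {k : ℕ} (hk : 1 ≤ k) (n : ℕ) : u k n ≤ F (4 * ((k : ℝ) - 1) / (k : ℝ) ^ 2) n 0 := by
  have hk0 : (0 : ℝ) < k := by exact_mod_cast hk
  set z0 : Fin k := ⟨0, hk⟩
  -- `cnt k n 0 ≤ #{pairs agreeing at letter z0}`
  have h1 : cnt k n 0 ≤ ∑ w : Fin n → Fin k, ∑ w' : Fin n → Fin k,
      if ∑ j, val (ψ z0 (w j, w' j)) = 0 then (1 : ℝ) else 0 := by
    unfold cnt
    refine sum_le_sum fun w _ => sum_le_sum fun w' _ => ?_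
    by_cases h : (0 : Fin k → ℤ) + pos w n = pos w' n
    · rw [if_pos h, if_pos]
      rw [zero_add] at h
      have hx := congr_fun h z0
      simp only [pos, Fin.is_lt, true_and] at hx
      simp only [val_ψ, sum_sub_distrib, hx, sub_self]
    · rw [if_neg h]; split_ifs <;> norm_num
  -- the right-hand side, normalised, is `Wsum`
  have h2 : (∑ w : Fin n → Fin k, ∑ w' : Fin n → Fin k,
      if ∑ j, val (ψ z0 (w j, w' j)) = 0 then (1 : ℝ) else 0) / (k : ℝ) ^ (2 * n) =
      Wsum (4 * ((k : ℝ) - 1) / (k : ℝ) ^ 2) n 0 := by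
    rw [sum_pair_eq (fun w w' : Fin n → Fin k => if ∑ j, val (ψ z0 (w j, w' j)) = 0 then (1 : ℝ) else 0)]
    simp only [Prod.mk.eta]
    have step := sum_prod_comp (ψ z0) (fun _ : Fin k × Fin k => (1 : ℝ) / (k : ℝ) ^ 2) n
      (fun v => if ∑ j, val (v j) = 0 then (1 : ℝ) else 0)
    simp only [prod_const, card_univ, Fintype.card_fin, Function.comp_def] at step
    rw [show ((1 : ℝ) / (k : ℝ) ^ 2) ^ n = 1 / (k : ℝ) ^ (2 * n) by
      rw [one_div, inv_pow, ← pow_mul, one_div]] at step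
    rw [div_eq_mul_one_div, mul_comm, mul_sum, step, Wsum]
    refine sum_congr rfl fun v _ => ?_
    congr 1
    exact prod_congr rfl fun j _ => sum_fibre_ψ hk z0 (v j)
  rw [u, ← Wsum_eq_F, ← h2]
  exact div_le_div_of_nonneg_right h1 (by positivity)

/-- **`u k n ² ≤ k² / (4 (k-1) (n+1))`** for `k ≥ 2`. -/
theorem u_sq_le {k : ℕ} (hk : 2 ≤ k) (n : ℕ) : u k n ^ 2 ≤ (k : ℝ) ^ 2 / (4 * ((k : ℝ) - 1) * ((n : ℝ) + 1)) := by
  have hk1 : (1 : ℝ) ≤ (k : ℝ) - 1 := by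
    have : (2 : ℝ) ≤ k := by exact_mod_cast hk
    linarith
  have hkpos : (0 : ℝ) < k := by positivity
  set s : ℝ := 4 * ((k : ℝ) - 1) / (k : ℝ) ^ 2 with hs
  have hs0 : 0 < s := by rw [hs]; positivity
  have hs1 : s ≤ 1 := by
    rw [hs, div_le_one (by positivity)]; nlinarith
  have h0 : 0 ≤ u k n := u_nonneg n
  calc u k n ^ 2 ≤ F s n 0 ^ 2 := pow_le_pow_left₀ h0 (u_le_F (by omega) n) 2
    _ ≤ 1 / (((n : ℝ) + 1) * s) := F_zero_sq_le hs0 hs1 n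
    _ = (k : ℝ) ^ 2 / (4 * ((k : ℝ) - 1) * ((n : ℝ) + 1)) := by
        rw [hs]; field_simp

end Summit.CriticalPhenomena.PercolationContinuityZ3.Theorems.Pcint.BSM

end
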